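import Mathlib
import Summits.AtomisticToContinuum.FouriersLaw.Theses.EmbeddedDrudeMourre
import Summits.AtomisticToContinuum.FouriersLaw.Theorems.EmbeddedDrudeMourreDrudeDissolutionStubFreeOddExcursionKernelFGR
import Summits.AtomisticToContinuum.FouriersLaw.Theorems.EmbeddedDrudeMourreDrudeDissolutionStubFreeForceKernelReduction
import Summits.AtomisticToContinuum.FouriersLaw.Theorems.EmbeddedDrudeMourreMourreDissolutionFreeLevelShift
import Summits.AtomisticToContinuum.FouriersLaw.Theorems.EmbeddedDrudeMourreMourreDissolutionLevelShiftPushforward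
import HarnessLib

/-!
# The free odd excursion kernel has a continuous Abelian spectral function through the threshold
(crux `EmbeddedDrudeMourre.DrudeDissolution`, item stmt-AtomisticToContinuum-12593; `--supports` file, closes
nothing; lead c11; lines `kinetic-polymer-gas-on-the-time-axis` (stub B) and `gram-pencil-harmonic-chaos` (stub K))

WHAT. For `ω₂ > 0`, couplings `a, b` and a `2π`-periodic `C³` profile `f`, the explicit free `(2,2)`-sector
kernel of the two lines,
`F_f(t) = ∫_{(−π,π]³} Φ²·[f]²·(ω₁ω₂ω₃ω₄)⁻²·cos(tΩ) dk`
(`Φ = vertex a b`, `[f] = f₁+f₂−f₃−f₄`, `Ω = resonanceFn ω₂`; stub B of the polymer line verbatim), IS the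
cosine transform of the bracket-weighted two-phonon density of states `m_f = Ω_*(W dk)` of the sibling crux
stmt-12594 (`freeOddExcursionKernel_eq_cosTransform`), and therefore (sibling's LANDED `thresholdDensity`:
`m_f` has near `0` a continuous density `ρ ≥ 0` with `πρ(0) = (64π²/9)·q(f)`) its Abel–cosine transforms
`A_ν(ω) = ∫_{t>0} e^{−νt} cos(ωt) F_f(t) dt` converge LOCALLY UNIFORMLY on a window `(−δ, δ)` as `ν ↓ 0` to
the continuous function `π(ρ(ω) + ρ(−ω))/2`, whose value at `0` is `(64π²/9)·q(f)` — positive exactly when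
ALS's collision form of `f` is (`HasOddSectorGap` for odd `f ≠ 0`). This is the registered sub-goal
`freeOddExcursionKernel_abelWindow`.

WHY (role). It is the conclusion of stub K of line `gram-pencil-harmonic-chaos` (locally uniform Abelian limit,
continuous `ρ`, `ρ(0) > 0`) for the EXPLICIT kernel `F_f` instead of the free force kernel
`K₀(t) = Z₀.form Φ (Φ ∘ φ⁰_t)`: the analytic ("threshold", K2) half of K is thereby a theorem of the tree, and
what remains of K is the Wick/normal-mode identification of `K₀` with such explicit shell integrals (K1, the
missing instance of `HarmonicChaosDecomposition`). For the polymer line it is the frequency-resolved form of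
stub B's Fermi-golden-rule identity (`tendsto_abel_freeOddExcursionKernel`, landed): the symmetric kinetic
generator of stubs D/M(iii) has a continuous spectral function at the threshold.

HOW. `∫ cos(xt) dm_f(x) = ∫ W·cos(tΩ) d(cell)` (`levelShift_integral_map_withDensity`) `= F_f(t)` (the
volume-preserving reindexing `fgr_setIntegral_cell_eq`); then the landed reduction lemma of stub K,
`GramPencilHarmonicChaos.tendstoLocallyUniformlyOn_abelCos_of_window`, fed with the sibling's window.
-/

noncomputable section

open MeasureTheory Filter Set Function Topology Real
open scoped ENNReal NNReal Topology
open Literature.MathematicalPhysics.KineticTheory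
open Literature.MathematicalPhysics.KineticTheory.PhononBoltzmann

namespace Summit.AtomisticToContinuum.FouriersLaw.Theorems.DrudeDissolution.KineticPolymerGasOnTheTimeAxis

/-- **The free odd excursion kernel is the cosine transform of the weighted two-phonon density of
states.** For `ω₂ > 0`, `a, b` and a continuous profile `f`, with `m_f = Ω_*(W dk)` the (finite) pushforward
measure of stub B0 of the sibling crux (`W = Φ²/(∏ω)²·[f]²` on the cell, read at `p = (k₁,(k₃,k₂))`):
`F_f(t) = ∫ cos(xt) dm_f(x)` for every `t`. [folklore] -/
theorem freeOddExcursionKernel_eq_cosTransform (ω₂ a b : ℝ) (hω : 0 < ω₂) (f : ℝ → ℝ) (hf : Continuous f)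
    (t : ℝ) :
    (∫ k in Set.pi Set.univ (fun _ : Fin 3 => Set.Ioc (-Real.pi) Real.pi),
        vertex a b (k 0) (k 1) (k 2) ^ 2 *
          (f (k 0) + f (k 1) - f (k 2) - f (k 0 + k 1 - k 2)) ^ 2 /
          (dispersion ω₂ (k 0) * dispersion ω₂ (k 1) * dispersion ω₂ (k 2) *
            dispersion ω₂ (k 0 + k 1 - k 2)) ^ 2 *
          Real.cos (t * resonanceFn ω₂ (k 0) (k 1) (k 2))) =
      ∫ x, Real.cos (x * t) ∂(MeasureTheory.Measure.map (fun p : ℝ × ℝ × ℝ => resonanceFn ω₂ p.1 p.2.2 p.2.1)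
          (((volume.restrict (Set.Ioc (-Real.pi) Real.pi)).prod
              ((volume.restrict (Set.Ioc (-Real.pi) Real.pi)).prod
                (volume.restrict (Set.Ioc (-Real.pi) Real.pi)))).withDensity
            (fun p : ℝ × ℝ × ℝ => ENNReal.ofReal
              (vertex a b p.1 p.2.2 p.2.1 ^ 2 /
                  (dispersion ω₂ p.1 * dispersion ω₂ p.2.2 * dispersion ω₂ p.2.1 *
                    dispersion ω₂ (p.1 + p.2.2 - p.2.1)) ^ 2 *
                (f p.1 + f p.2.2 - f p.2.1 - f (p.1 + p.2.2 - p.2.1)) ^ 2)))) := by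
  -- the weight, the resonance function and the cosine as continuous functions on `ℝ³`
  have hden : ∀ p : ℝ × ℝ × ℝ, (dispersion ω₂ p.1 * dispersion ω₂ p.2.2 * dispersion ω₂ p.2.1 *
      dispersion ω₂ (p.1 + p.2.2 - p.2.1)) ^ 2 ≠ 0 := fun p =>
    pow_ne_zero _ (mul_pos (mul_pos (mul_pos (dispersion_pos hω _) (dispersion_pos hω _))
      (dispersion_pos hω _)) (dispersion_pos hω _)).ne'
  have hV : Continuous fun p : ℝ × ℝ × ℝ => vertex a b p.1 p.2.2 p.2.1 ^ 2 := by fun_prop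
  have hD : Continuous fun p : ℝ × ℝ × ℝ => (dispersion ω₂ p.1 * dispersion ω₂ p.2.2 *
      dispersion ω₂ p.2.1 * dispersion ω₂ (p.1 + p.2.2 - p.2.1)) ^ 2 := by fun_prop
  have hB : Continuous fun p : ℝ × ℝ × ℝ =>
      (f p.1 + f p.2.2 - f p.2.1 - f (p.1 + p.2.2 - p.2.1)) ^ 2 := by fun_prop
  have hW : Continuous fun p : ℝ × ℝ × ℝ => vertex a b p.1 p.2.2 p.2.1 ^ 2 /
      (dispersion ω₂ p.1 * dispersion ω₂ p.2.2 * dispersion ω₂ p.2.1 *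
        dispersion ω₂ (p.1 + p.2.2 - p.2.1)) ^ 2 *
      (f p.1 + f p.2.2 - f p.2.1 - f (p.1 + p.2.2 - p.2.1)) ^ 2 := (hV.div hD hden).mul hB
  have hW0 : ∀ p : ℝ × ℝ × ℝ, 0 ≤ vertex a b p.1 p.2.2 p.2.1 ^ 2 /
      (dispersion ω₂ p.1 * dispersion ω₂ p.2.2 * dispersion ω₂ p.2.1 *
        dispersion ω₂ (p.1 + p.2.2 - p.2.1)) ^ 2 *
      (f p.1 + f p.2.2 - f p.2.1 - f (p.1 + p.2.2 - p.2.1)) ^ 2 := fun p => by positivity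
  have hΩ : Continuous fun p : ℝ × ℝ × ℝ => resonanceFn ω₂ p.1 p.2.2 p.2.1 := by fun_prop
  have hP : Continuous fun x : ℝ => Real.cos (x * t) := by fun_prop
  rw [MourreDissolution.levelShift_integral_map_withDensity hW hW0 hΩ hP]
  -- the integral over the product of restricted measures is the box integral, reindexed
  rw [← fgr_setIntegral_cell_eq (fun p : ℝ × ℝ × ℝ => vertex a b p.1 p.2.2 p.2.1 ^ 2 /
      (dispersion ω₂ p.1 * dispersion ω₂ p.2.2 * dispersion ω₂ p.2.1 *
        dispersion ω₂ (p.1 + p.2.2 - p.2.1)) ^ 2 *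
      (f p.1 + f p.2.2 - f p.2.1 - f (p.1 + p.2.2 - p.2.1)) ^ 2 *
      Real.cos (resonanceFn ω₂ p.1 p.2.2 p.2.1 * t)) (Set.Ioc (-Real.pi) Real.pi)]
  refine integral_congr_ae (ae_of_all _ (fun k => ?_))
  simp only
  rw [mul_comm (resonanceFn ω₂ (k 0) (k 1) (k 2)) t]
  ring

/-- **Registered sub-goal `freeOddExcursionKernel_abelWindow` (lead c11): the free odd excursion kernel has
a continuous Abelian spectral function through the pair threshold, with the Fermi-golden-rule value.**
For `ω₂ > 0`, `a, b` and a `2π`-periodic `C³` profile `f` there are `δ > 0` and `ρ` continuous and `≥ 0`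
on `(−δ, δ)` with `πρ(0) = (64π²/9)·q_{ω₂,a,b}(f)` such that the Abel–cosine transforms
`ω ↦ ∫_{t>0} e^{−νt} cos(ωt) F_f(t) dt` of the kernel of stub B converge to `π(ρ(ω) + ρ(−ω))/2` LOCALLY
UNIFORMLY on `(−δ, δ)` as `ν ↓ 0`. (The shape of stub K of line `gram-pencil-harmonic-chaos`, for the explicit
`(2,2)` kernel; `ρ` is the sibling crux's threshold density `thresholdDensity`.)
[cite: AokiLukkarinenSpohn2006, eqs. (3.17)-(3.20), (4.1), (4.10)-(4.11), (4.16)] -/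
theorem freeOddExcursionKernel_abelWindow : ∀ ω₂ a b : ℝ, 0 < ω₂ → ∀ f : ℝ → ℝ, Function.Periodic f (2 * Real.pi) → ContDiff ℝ 3 f → ∃ δ : ℝ, 0 < δ ∧ ∃ ρ : ℝ → ℝ, ContinuousOn ρ (Set.Ioo (-δ) δ) ∧ (∀ x ∈ Set.Ioo (-δ) δ, 0 ≤ ρ x) ∧ ENNReal.ofReal (Real.pi * ρ 0) = ENNReal.ofReal (64 * Real.pi ^ 2 / 9) * Literature.MathematicalPhysics.KineticTheory.PhononBoltzmann.boltzmannForm ω₂ a b f ∧ TendstoLocallyUniformlyOn (fun (ν : ℝ) (ω : ℝ) => ∫ t in Set.Ioi (0 : ℝ), Real.exp (-(ν * t)) * (Real.cos (ω * t) * ∫ k in Set.pi Set.univ (fun _ : Fin 3 => Set.Ioc (-Real.pi) Real.pi), Literature.MathematicalPhysics.KineticTheory.PhononBoltzmann.vertex a b (k 0) (k 1) (k 2) ^ 2 * (f (k 0) + f (k 1) - f (k 2) - f (k 0 + k 1 - k 2)) ^ 2 / (Literature.MathematicalPhysics.KineticTheory.PhononBoltzmann.dispersion ω₂ (k 0) *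 Literature.MathematicalPhysics.KineticTheory.PhononBoltzmann.dispersion ω₂ (k 1) * Literature.MathematicalPhysics.KineticTheory.PhononBoltzmann.dispersion ω₂ (k 2) * Literature.MathematicalPhysics.KineticTheory.PhononBoltzmann.dispersion ω₂ (k 0 + k 1 - k 2)) ^ 2 * Real.cos (t * Literature.MathematicalPhysics.KineticTheory.PhononBoltzmann.resonanceFn ω₂ (k 0) (k 1) (k 2)))) (fun ω => Real.pi * ((ρ ω + ρ (-ω)) / 2)) (nhdsWithin 0 (Set.Ioi 0)) (Set.Ioo (-δ) δ) := by
  intro ω₂ a b hω f hper hf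
  -- the sibling's threshold density and window
  obtain ⟨δ, hδ, ρ, hρc, hρ0, hval, hwin⟩ := MourreDissolution.thresholdDensity ω₂ a b hω f hper hf
  -- the pushforward measure is finite
  obtain ⟨hfin, -⟩ := MourreDissolution.stub_levelShiftPushforward ω₂ a b hω f hf.continuous
  refine ⟨δ, hδ, ρ, hρc, hρ0, ?_, ?_⟩
  · rw [hval, fgr_four_pi_div_alsPrefactor]
  · exact GramPencilHarmonicChaos.tendstoLocallyUniformlyOn_abelCos_of_window _ hfin _
      (fun t => freeOddExcursionKernel_eq_cosTransform ω₂ a b hω f hf.continuous t) δ hδ ρ hρc hρ0 hwin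

end Summit.AtomisticToContinuum.FouriersLaw.Theorems.DrudeDissolution.KineticPolymerGasOnTheTimeAxis

end
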